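import Summits.ABC.StewartYu.PadicG3SatNHalfSizes
import Summits.ABC.StewartYu.PadicG3SatLineAlg
import Summits.ABC.StewartYu.PadicG3VbLinesK
import Literature.NumberTheory.Transcendental.PadicCW77Assembly
import HarnessLib

/-!
# Cell abc-stewartyu, WP-L.P(odd) (crux r3 `PadicCoreOddRat`, stmt-ABC-20503): the k-step and half-step LINES of the saturated pack on `schedN b`,
# BUDGET-PARAMETRIC (the record's two inequalities per family enter as hypotheses `hfar` / `hlam`)

`Summits/ABC/StewartYu/PadicG3SatNLines.lean` — cell `abc-stewartyu` (seat p2-g6; pack twin, lines; record owner p1 g10).  Proofs only; no definition,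
no named fact.  Twin of `PadicG3VbLinesK.kstep_line_Vb` / `PadicG3VbHalfLine.half_line_Vb` (p3-g7) for `F : S.SatData` on `P.schedN b`
(`P : PadicG3ParN S.n`, `θ₀ = 1/2`), with the sizes of `PadicG3SatNSizesB` / `PadicG3SatNHalfSizes` and the algebra of `PadicG3SatLineAlg`;
the numeric budget (p1's `PadicG3ParNF`) is abstracted into:
* k-step at stage `ν`, level `lev ≤ ŜN`: `hfar : L0N(G+1) + KB ν < G·E`, `hlam : L0N(G+1) − U + AcondV lev ν + KB ν < 0`, where
  `KB ν = 4 log 2 + 2ℓU + 2T0r(ŜN log 2 + (23/20)HV + cX) + 2HV/e + 2L0N(ŜN+n+6)log 2 + 2htsV 0 + 4htsV ν + 8ΣA` (`log_KCsat_N_le`);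
* half-step at level `lev < ŜN`: `hfar : L0N(G+1) + 2^{n+1}·HB < G·((2·NS lev n + 1)·tS lev)`, `hlam : L0N(G+1) − U + AcondV lev n + 2^{n+1}·HB < 0`,
  `HB` = the bound of `log_half_threshold_N_le`.

* `log_BwP_le_gen` (`log BwP(L₀, m) ≤ L₀(G+1)` for any `L₀`), `pow_half_tS_le_N`, `pow_condExp_le_N`;
* `kstep_line_N`, `half_line_N`.

References: Yu. V. Nesterenko, LNM 1819 (2003) §4.2 (4.29)–(4.35), §4.3 (4.38)–(4.45) (shape only).
-/

noncomputable section

open Finset Real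
open Literature.NumberTheory.Transcendental
open Literature.NumberTheory.Transcendental.PadicCW77 (condExp)
open Literature.NumberTheory.Transcendental.CW77.Setup (Tau tauNorm)

namespace Summit.ABC.StewartYu

namespace PadicG3Par

variable {n : ℕ} (P : PadicG3Par n)

/-- `log BwP(L₀, m) ≤ L₀·(G + 1)` for every `L₀` (`θ₀ = 1/2`; `⌊L₀/(p−1)⌋·log p ≤ L₀`). [folklore] -/
theorem log_BwP_le_gen (hθ : P.θ₀ = 1 / 2) (L₀ : ℕ) :
    Real.log ((P.p : ℝ) ^ (L₀ / (P.p - 1)) * ((P.p : ℝ) ^ P.m * Real.sqrt P.p) ^ L₀) ≤ L₀ * (P.G + 1) := by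
  have hp2 : 2 ≤ P.p := P.hp
  have hp2R : (2 : ℝ) ≤ P.p := by exact_mod_cast hp2
  have hp : (0 : ℝ) < P.p := by linarith
  rw [P.rho_pow_eq_exp hθ, Real.log_mul (by positivity) (Real.exp_pos _).ne', Real.log_exp, Real.log_pow]
  have hlogp : Real.log (P.p : ℝ) ≤ (P.p : ℝ) - 1 := Real.log_le_sub_one_of_pos hp
  have hdivN : (L₀ / (P.p - 1)) * (P.p - 1) ≤ L₀ := Nat.div_mul_le_self L₀ (P.p - 1)
  have hcast : (((P.p - 1 : ℕ) : ℝ)) = (P.p : ℝ) - 1 := by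
    rw [Nat.cast_sub (le_trans one_le_two hp2)]; push_cast; ring
  have hdiv : ((L₀ / (P.p - 1) : ℕ) : ℝ) * ((P.p : ℝ) - 1) ≤ L₀ := by
    have h := (Nat.cast_le (α := ℝ)).mpr hdivN
    rw [Nat.cast_mul, hcast] at h
    exact h
  have hq0 : (0 : ℝ) ≤ ((L₀ / (P.p - 1) : ℕ) : ℝ) := Nat.cast_nonneg _
  nlinarith [mul_le_mul_of_nonneg_left hlogp hq0]

end PadicG3Par

namespace G3Setup

variable {p : ℕ} [Fact p.Prime] (S : G3Setup p) (F : S.SatData) (P : PadicG3ParN S.n) (b : ℝ)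

/-- `p^{(tS lev − 1)/2} ≤ exp(4·LgV·log p)` on `schedN`. [folklore] -/
theorem pow_half_tS_le_N (hp : P.p = p) (lev : ℕ) :
    (p : ℝ) ^ ((S.tS (P.schedN b) lev - 1) / 2) ≤ Real.exp (4 * P.LgV * Real.log P.p) := by
  have hprime : p.Prime := Fact.out
  have hpR : (2 : ℝ) ≤ p := by exact_mod_cast hprime.two_le
  have hlogp : 0 ≤ Real.log (p : ℝ) := Real.log_nonneg (by linarith)
  have ht : (S.tS (P.schedN b) lev - 1) / 2 ≤ 4 * P.LgV := by
    rw [S.tS_N P b]; have := P.TV_le lev; omega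
  rw [hp, ← Real.rpow_natCast, Real.rpow_def_of_pos (by linarith)]
  refine Real.exp_le_exp.mpr ?_
  have : (((S.tS (P.schedN b) lev - 1) / 2 : ℕ) : ℝ) ≤ 4 * P.LgV := by exact_mod_cast ht
  nlinarith

/-- `p^{condExp p kpts (tS lev)} ≤ exp(AcondV lev ν − 4·LgV·log p)` for `1 ≤ kpts ≤ 2·NS lev ν + 1` on `schedN`.
[cite: Nesterenko2003, §4.2 (4.33); shape only] -/
theorem pow_condExp_le_N (hp : P.p = p) (lev ν : ℕ) {kpts : ℕ} (hk1 : 1 ≤ kpts) (hk : kpts ≤ 2 * S.NS (P.schedN b) lev ν + 1) :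
    (p : ℝ) ^ condExp p kpts (S.tS (P.schedN b) lev) ≤ Real.exp (P.AcondV lev ν - 4 * P.LgV * Real.log P.p) := by
  have hprime : p.Prime := Fact.out
  have hp2 : 2 ≤ p := hprime.two_le
  have hpR : (2 : ℝ) ≤ p := by exact_mod_cast hp2
  have hcond := PadicCW77.condExp_mul_log_le hp2 kpts (S.tS (P.schedN b) lev)
  obtain ⟨_, hκ0⟩ := P.kappa_le_one
  rw [hp] at hκ0
  have hkR : (kpts : ℝ) ≤ 2 ^ (ν + 1) * P.XsV lev + 1 := by
    have : (kpts : ℝ) ≤ ((2 * S.NS (P.schedN b) lev ν + 1 : ℕ) : ℝ) := by exact_mod_cast hk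
    rw [S.NS_N P b] at this; push_cast at this; rw [pow_succ]; linarith
  have hk1R : (1 : ℝ) ≤ kpts := by exact_mod_cast hk1
  have htS : ((S.tS (P.schedN b) lev : ℕ) : ℝ) = P.TV lev + 1 := by rw [S.tS_N P b]; push_cast; ring
  have hAdef : P.AcondV lev ν - 4 * P.LgV * Real.log P.p =
      (2 ^ (ν + 1) * P.XsV lev + 1) * (P.TV lev + 1) * (Real.log p / (p - 1)) +
        (P.TV lev + 1) * Real.log (2 * (2 ^ (ν + 1) * P.XsV lev + 1)) := by
    unfold PadicG3Par.AcondV; rw [hp]; ring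
  rw [← Real.rpow_natCast, Real.rpow_def_of_pos (by linarith), hAdef]
  refine Real.exp_le_exp.mpr ?_
  rw [htS] at hcond
  have hlogk : Real.log (2 * (kpts : ℝ)) ≤ Real.log (2 * (2 ^ (ν + 1) * P.XsV lev + 1)) :=
    Real.log_le_log (by linarith) (by linarith)
  have hT0 : (0 : ℝ) ≤ P.TV lev + 1 := by positivity
  have e1 : (kpts : ℝ) * (P.TV lev + 1) * (Real.log p / (p - 1)) ≤
      (2 ^ (ν + 1) * P.XsV lev + 1) * (P.TV lev + 1) * (Real.log p / (p - 1)) :=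
    mul_le_mul_of_nonneg_right (mul_le_mul_of_nonneg_right hkR hT0) hκ0
  have e2 : (P.TV lev + 1 : ℝ) * Real.log (2 * (kpts : ℝ)) ≤ (P.TV lev + 1) * Real.log (2 * (2 ^ (ν + 1) * P.XsV lev + 1)) :=
    mul_le_mul_of_nonneg_left hlogk hT0
  rw [mul_comm]
  linarith [hcond, e1, e2]

/-- **THE k-STEP LINE OF THE SATURATED PACK at `schedN b`, budget-parametric** (all three k-step families).
[cite: Nesterenko2003, §4.2 (4.29)–(4.35); shape only] -/
theorem kstep_line_N (hp : P.p = p) (hθ : P.θ₀ = 1 / 2) (hb : 1 ≤ b) (hn : 1 ≤ S.n) (hA1 : ∀ j, 1 ≤ P.A j)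
    (hαA : ∀ j, Height.logHeight₁ (F.αo j) ≤ P.A j) (hbW : ∀ j, Real.log (max 3 (|S.b j| : ℝ)) ≤ P.W)
    (hC : ∀ j k, |F.C j k| ≤ ((S.n.factorial * F.N : ℕ) : ℤ))
    {T0r : ℝ} (hT0 : (S.TordS (P.schedN b) 0 0 : ℝ) ≤ T0r) {cX : ℝ}
    (hcX : Real.log 2 + 3 * Real.log S.n + Real.log S.n.factorial + Real.log F.N + P.W + Real.log P.LV ≤ cX)
    {U : ℝ} (hΛU : ‖S.Λ / (S.b S.j₀ : ℚ_[p])‖ ≤ Real.exp (-U))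
    {lev ν : ℕ} (hlev : lev ≤ P.SdN) (hν : ν + 1 ≤ S.n) {x₁ : ℤ} (hx : |x₁| ≤ (S.NS (P.schedN b) lev (ν + 1) : ℤ))
    (τ : Tau S.n) (hτ : tauNorm τ ≤ S.TordS (P.schedN b) 0 0)
    {kpts : ℕ} (hk1 : 1 ≤ kpts) (hk : kpts ≤ 2 * S.NS (P.schedN b) lev ν + 1) {E : ℕ}
    (hfar : P.L0N * (P.G + 1) +
      (4 * Real.log 2 + 2 * (Real.log ((P.L0N : ℝ) + 1) + S.n * Real.log (S.n * S.n.factorial * F.N * P.LV + 1)) +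
        2 * (T0r * (P.SdN * Real.log 2 + 23 / 20 * P.HV + cX)) +
        2 * (P.HV / Real.exp 1) + 2 * (P.L0N * ((P.SdN + S.n + 6) * Real.log 2)) + 2 * P.htsV 0 + 4 * P.htsV ν + 8 * ∑ j, P.A j) <
      P.G * E)
    (hlam : P.L0N * (P.G + 1) - U + P.AcondV lev ν +
      (4 * Real.log 2 + 2 * (Real.log ((P.L0N : ℝ) + 1) + S.n * Real.log (S.n * S.n.factorial * F.N * P.LV + 1)) +
        2 * (T0r * (P.SdN * Real.log 2 + 23 / 20 * P.HV + cX)) +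
        2 * (P.HV / Real.exp 1) + 2 * (P.L0N * ((P.SdN + S.n + 6) * Real.log 2)) + 2 * P.htsV 0 + 4 * P.htsV ν + 8 * ∑ j, P.A j) < 0) :
    max (BwP (p := p) P.L0N P.m * ‖S.Λ / (S.b S.j₀ : ℚ_[p])‖ * (p : ℝ) ^ ((S.tS (P.schedN b) lev - 1) / 2) *
          (p : ℝ) ^ condExp p kpts (S.tS (P.schedN b) lev))
        (BwP (p := p) P.L0N P.m / ((p : ℝ) ^ P.m * Real.sqrt p) ^ E) <
      1 / S.KCsat F (S.UcardSat F (P.schedN b)) (S.PmaxSat F (P.schedN b)) P.L0N P.HV P.SdN lev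
        (S.Lb (S.LcS F (P.schedN b)) lev) (S.Lb (S.svS F (P.schedN b)) lev) x₁ τ := by
  have hKlog := S.log_KCsat_N_le F P b hb hn hA1 hαA hbW hC hT0 hcX hlev hν hx τ hτ
  have hP0 : (0 : ℤ) ≤ S.PmaxSat F (P.schedN b) := S.PmaxSat_nonneg F (P.schedN b)
  have hKpos : 0 < S.KCsat F (S.UcardSat F (P.schedN b)) (S.PmaxSat F (P.schedN b)) P.L0N P.HV P.SdN lev
      (S.Lb (S.LcS F (P.schedN b)) lev) (S.Lb (S.svS F (P.schedN b)) lev) x₁ τ :=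
    lt_of_lt_of_le zero_lt_one (S.one_le_KCsat F _ hP0 _ _ _ _ _ _ _ _)
  have hpR : (0 : ℝ) < p := by exact_mod_cast (Fact.out : p.Prime).pos
  have hBwpos : 0 < BwP (p := p) P.L0N P.m := by unfold BwP; positivity
  have hBwexp : BwP (p := p) P.L0N P.m ≤ Real.exp (P.L0N * (P.G + 1)) := by
    have h := P.log_BwP_le_gen hθ P.L0N
    rw [hp] at h
    rw [← Real.exp_log hBwpos]
    exact Real.exp_le_exp.mpr h
  have hrho : ((p : ℝ) ^ P.m * Real.sqrt p) ^ E = Real.exp (P.G * E) := by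
    have h := P.rho_pow_eq_exp hθ E; rw [hp] at h; exact h
  have hq1 := S.pow_half_tS_le_N P b hp lev
  have hq2 := S.pow_condExp_le_N P b hp lev ν hk1 hk
  refine SatLineAlg.kstep_line_of_budget hKpos hKlog hBwexp (norm_nonneg _) hΛU (pow_nonneg (Nat.cast_nonneg _) _) hq1
    (pow_nonneg (Nat.cast_nonneg _) _) hq2 hrho hfar ?_
  linarith

set_option maxHeartbeats 400000 in
/-- **THE HALF-STEP LINE OF THE SATURATED PACK at `schedN b`, budget-parametric** (the hH family).
[cite: Nesterenko2003, §4.3 (4.38)–(4.45); shape only] -/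
theorem half_line_N (hp : P.p = p) (hθ : P.θ₀ = 1 / 2) (hb : 1 ≤ b) (hn : 1 ≤ S.n) (hA1 : ∀ j, 1 ≤ P.A j)
    (hαA : ∀ j, Height.logHeight₁ (F.αo j) ≤ P.A j) (hbW : ∀ j, Real.log (max 3 (|S.b j| : ℝ)) ≤ P.W)
    (hC : ∀ j k, |F.C j k| ≤ ((S.n.factorial * F.N : ℕ) : ℤ)) (hUcol : ∀ j, (F.Ucol j : ℤ) ≤ S.n * F.N)
    (hθA : ∀ i, Height.logHeight₁ (S.α i) ≤ ∑ j, P.A j)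
    {T0r : ℝ} (hT0 : (S.TordS (P.schedN b) 0 0 : ℝ) ≤ T0r) {cX : ℝ}
    (hcX : Real.log 2 + 3 * Real.log S.n + Real.log S.n.factorial + Real.log F.N + P.W + Real.log P.LV ≤ cX)
    {Thr : ℝ} {lev : ℕ} (hTh : ((S.TordS (P.schedN b) lev S.n - S.tS (P.schedN b) lev : ℕ) : ℝ) ≤ Thr)
    {U : ℝ} (hΛU : ‖S.Λ / (S.b S.j₀ : ℚ_[p])‖ ≤ Real.exp (-U))
    (hlev : lev < P.SdN) {s₁ : ℤ} (hs : |s₁| ≤ (2 * (S.NhS (P.schedN b) (lev + 1) : ℤ) - 1 : ℤ))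
    (τ : Tau S.n) (hτ : tauNorm τ + S.tS (P.schedN b) lev ≤ S.TordS (P.schedN b) lev S.n)
    (hfar : P.L0N * (P.G + 1) + 2 ^ (S.n + 1) *
      (6 * Real.log 2 + 2 * (Real.log ((P.L0N : ℝ) + 1) + S.n * Real.log (S.n * S.n.factorial * F.N * P.LV + 1)) +
        T0r * (P.SdN * Real.log 2 + 23 / 20 * P.HV + cX) + 2 * (P.HV / Real.exp 1) + 2 * (P.L0N * ((P.SdN + S.n + 6) * Real.log 2)) +
        8 * P.htsV 0 + Thr * (P.SdN * Real.log 2 + Real.log 2 + 69 / 20 * P.HV + 2 * P.W + cX) + (6 * S.n + 10) * ∑ j, P.A j) <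
      P.G * (((2 * S.NS (P.schedN b) lev S.n + 1) * S.tS (P.schedN b) lev : ℕ) : ℝ))
    (hlam : P.L0N * (P.G + 1) - U + P.AcondV lev S.n + 2 ^ (S.n + 1) *
      (6 * Real.log 2 + 2 * (Real.log ((P.L0N : ℝ) + 1) + S.n * Real.log (S.n * S.n.factorial * F.N * P.LV + 1)) +
        T0r * (P.SdN * Real.log 2 + 23 / 20 * P.HV + cX) + 2 * (P.HV / Real.exp 1) + 2 * (P.L0N * ((P.SdN + S.n + 6) * Real.log 2)) +
        8 * P.htsV 0 + Thr * (P.SdN * Real.log 2 + Real.log 2 + 69 / 20 * P.HV + 2 * P.W + cX) + (6 * S.n + 10) * ∑ j, P.A j) < 0) :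
    max (BwP (p := p) P.L0N P.m * ‖S.Λ / (S.b S.j₀ : ℚ_[p])‖ * (p : ℝ) ^ ((S.tS (P.schedN b) lev - 1) / 2) *
          (p : ℝ) ^ condExp p (2 * S.NS (P.schedN b) lev S.n + 1) (S.tS (P.schedN b) lev))
        (BwP (p := p) P.L0N P.m / ((p : ℝ) ^ P.m * Real.sqrt p) ^ ((2 * S.NS (P.schedN b) lev S.n + 1) * S.tS (P.schedN b) lev)) <
      (S.DCsat F (S.Lb (S.svS F (P.schedN b)) lev) P.HV s₁ τ : ℝ) /
        (4 * (S.DCsat F (S.Lb (S.svS F (P.schedN b)) lev) P.HV s₁ τ : ℝ) ^ 2 *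
          (1 + (S.UcardSat F (P.schedN b) : ℝ) * (S.PmaxSat F (P.schedN b)) *
            S.MhCsat F (S.Lb (S.LcS F (P.schedN b)) lev) (S.Lb (S.svS F (P.schedN b)) lev) P.L0N P.HV P.SdN lev s₁ τ) *
          CW77.heightProd S.α ^ 3) ^ (2 ^ (S.n + 1)) := by
  have hMlog := S.log_half_threshold_N_le F P b hb hn hA1 hαA hbW hC hUcol hθA hT0 hcX hTh hlev hs τ hτ
  have hD1 : (1 : ℝ) ≤ (S.DCsat F (S.Lb (S.svS F (P.schedN b)) lev) P.HV s₁ τ : ℝ) := by exact_mod_cast S.one_le_DCsat F _ _ _ _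
  obtain ⟨hP1, _⟩ := S.PmaxSat_le_two_mul F (P.schedN b)
  have hQ0 := S.MhCsat_nonneg F (S.Lb (S.LcS F (P.schedN b)) lev) (S.Lb (S.svS F (P.schedN b)) lev) P.L0N P.HV P.SdN lev s₁ τ
  have hHp1 := CW77.one_le_heightProd S.α
  have hP0 : (0 : ℝ) ≤ (S.PmaxSat F (P.schedN b) : ℝ) := le_trans zero_le_one hP1
  have hMpos : 0 < 4 * (S.DCsat F (S.Lb (S.svS F (P.schedN b)) lev) P.HV s₁ τ : ℝ) ^ 2 *
      (1 + (S.UcardSat F (P.schedN b) : ℝ) * (S.PmaxSat F (P.schedN b)) *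
        S.MhCsat F (S.Lb (S.LcS F (P.schedN b)) lev) (S.Lb (S.svS F (P.schedN b)) lev) P.L0N P.HV P.SdN lev s₁ τ) *
      CW77.heightProd S.α ^ 3 := by positivity
  have hpR : (0 : ℝ) < p := by exact_mod_cast (Fact.out : p.Prime).pos
  have hBwpos : 0 < BwP (p := p) P.L0N P.m := by unfold BwP; positivity
  have hBwexp : BwP (p := p) P.L0N P.m ≤ Real.exp (P.L0N * (P.G + 1)) := by
    have h := P.log_BwP_le_gen hθ P.L0N
    rw [hp] at h
    rw [← Real.exp_log hBwpos]
    exact Real.exp_le_exp.mpr h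
  have hrho : ((p : ℝ) ^ P.m * Real.sqrt p) ^ ((2 * S.NS (P.schedN b) lev S.n + 1) * S.tS (P.schedN b) lev) =
      Real.exp (P.G * (((2 * S.NS (P.schedN b) lev S.n + 1) * S.tS (P.schedN b) lev : ℕ) : ℝ)) := by
    have h := P.rho_pow_eq_exp hθ ((2 * S.NS (P.schedN b) lev S.n + 1) * S.tS (P.schedN b) lev); rw [hp] at h; exact h
  have hq1 := S.pow_half_tS_le_N P b hp lev
  have hk1 : 1 ≤ 2 * S.NS (P.schedN b) lev S.n + 1 := by omega
  have hq2 := S.pow_condExp_le_N P b hp lev S.n hk1 le_rfl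
  refine SatLineAlg.half_line_of_budget (e := 2 ^ (S.n + 1)) hMpos hMlog hD1 hBwpos hBwexp (norm_nonneg _) hΛU
    (pow_nonneg (Nat.cast_nonneg _) _) hq1 (pow_nonneg (Nat.cast_nonneg _) _) hq2 hrho ?_ ?_
  · push_cast at hfar ⊢; linarith
  · push_cast at hlam ⊢; linarith

end G3Setup

end Summit.ABC.StewartYu

end
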